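import Mathlib
import Summits.Schanuel.Schanuel.Theses.MatrixCoefficients

/-!
# Line `loghom-scaling` for LEAF 2 `LogHomogeneity` of the grading split of `LogSector` (stmt-Schanuel-4310)

Seat `planner-cstrat-stmt-Schanuel-4310-r1-0` (crux-strategist, BC2 redirect; "a plan for both sides").
LEAF 2 (`LogHomogeneity`, filed as a child of `MatrixCoefficients.LogSector` in children.json; until the
split lands it is concluded here as its verbatim statement `LogHomogeneityStatement`): every rational
polynomial relation `P(l) = 0` among logarithms of algebraic numbers holds homogeneous component by
homogeneous component.

THE LINE: SCALING SYMMETRY. LEAF 2 says exactly that the `ℚ`-Zariski closure of a point of `𝓛^r` is a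
CONE; a cone is what is left invariant by the scalings `z ↦ μ z`, and ONE scaling by a non-root of unity `μ`
realised by a ring endomorphism `σ` of `ℂ` (`σ(l) = μ·l` for every `l ∈ 𝓛`, `σ(μ) = μ`) already forces it:
applying `σ^k` to `P(l) = 0` gives `P(μ^k l) = Σ_d μ^{kd} P_d(l) = 0` for all `k`, a Vandermonde system in the
distinct nodes `μ^d`. This is the transferred Denis/Carlitz symmetry of route TwistedConjugacy, WEAKENED to
what LEAF 2 needs: no intertwining with `exp` is asked, only the rescaling on `𝓛` (TwistedConjugacy's
`TwistedSymmetry` gives it with `μ ↦ μ⁻¹`, their item `TwistImpliesLogHomogeneity`; under `LogSector` it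
holds with `μ = 2`, `σ` an automorphism of `ℂ` extending `X ↦ 2X` on the polynomial ring `ℚ[𝓛-basis]`).

* `stub_logScalingEndomorphism` (OPEN, hard; the symmetry form of LEAF 2): there are `μ ∈ ℂˣ` not a root of
  unity and a ring endomorphism `σ` of `ℂ` with `σ μ = μ` and `σ l = μ·l` for every logarithm `l` of an
  algebraic number.
* `stub_scalingDescent` (provable now, S/M): if `P(μ^k • l) = 0` for every `k ∈ ℕ` with `μ ≠ 0` not a root of
  unity, then every homogeneous component of `P` vanishes at `l` (the one-variable polynomial
  `s ↦ Σ_d P_d(l) s^d` has the infinitely many roots `μ^k`).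
* `logHomogeneity_of` — real proof: `σ^k (P(l)) = P(σ^k ∘ l) = P(μ^k • l)` (ring endomorphisms of `ℂ` are
  `ℚ`-algebra maps; `σ^k l = μ^k l` by induction using `σ μ = μ`), then stub 2.

Costume check: stub 1 is not LEAF 2 reworded (it is an existence statement about `End(ℂ)`; LEAF 2 ⟹ it only
through `LogSector`-strength input or Zilber-type categoricity), not the crux, not the summit; stub 2 is pure
algebra. Probes: `stub_logScalingEndomorphism → LogHomogeneityStatement` / `→ Schanuel` by
`exact? | simpa | aesop` FAIL (bc/ files of the seat). Disproof used: none registered for the item.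
-/

noncomputable section

set_option linter.dupNamespace false

namespace Summit.Schanuel.Schanuel.Cruxes.LogSector.LogHomScaling

/-- LEAF 2 of the grading split, verbatim the child statement `LogHomogeneity` filed in children.json
(concluded by name here until `route edit --split` writes `MatrixCoefficients.LogHomogeneity`). -/
def LogHomogeneityStatement : Prop :=
  ∀ (r : ℕ) (l : Fin r → ℂ), (∀ j, IsAlgebraic ℚ (Complex.exp (l j))) →
    ∀ P : MvPolynomial (Fin r) ℚ, MvPolynomial.aeval l P = 0 →
      ∀ d : ℕ, MvPolynomial.aeval l (MvPolynomial.homogeneousComponent d P) = 0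

/-- STUB 1 (OPEN, hard): a LOG-SCALING ENDOMORPHISM of `ℂ` — some `μ ≠ 0`, not a root of unity, and a ring
endomorphism `σ : ℂ → ℂ` with `σ μ = μ` rescaling every logarithm of an algebraic number: `σ l = μ·l`.
[Denis1995 Thm 3 / Cor 2 (the Carlitz-module symmetry `T ↦ ξT`); route TwistedConjugacy, items
`TwistedSymmetry`, `TwistImpliesLogHomogeneity`; Zilber2005 (categoricity predicts such `σ` on `𝔹`)] -/
theorem stub_logScalingEndomorphism :
    ∃ (μ : ℂ) (σ : ℂ →+* ℂ), μ ≠ 0 ∧ (∀ k : ℕ, 0 < k → μ ^ k ≠ 1) ∧ σ μ = μ ∧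
      ∀ z : ℂ, IsAlgebraic ℚ (Complex.exp z) → σ z = μ * z := by
  sorry

/-- STUB 2 (provable now, S/M): SCALING DESCENT — if a rational polynomial vanishes at all the rescalings
`μ^k • l` (`k ∈ ℕ`) of a point, with `μ ≠ 0` not a root of unity, then each of its homogeneous components
vanishes at `l` (Vandermonde in the distinct nodes `μ^d`, or: the polynomial `s ↦ Σ_d P_d(l) s^d` has
infinitely many roots). [folklore; Mathlib `Matrix.det_vandermonde`, `Polynomial.eq_zero_of_infinite_isRoot`] -/
theorem stub_scalingDescent :
    ∀ (r : ℕ) (l : Fin r → ℂ) (P : MvPolynomial (Fin r) ℚ) (μ : ℂ), μ ≠ 0 →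
      (∀ k : ℕ, 0 < k → μ ^ k ≠ 1) → (∀ k : ℕ, MvPolynomial.aeval ((μ ^ k) • l) P = 0) →
        ∀ d : ℕ, MvPolynomial.aeval l (MvPolynomial.homogeneousComponent d P) = 0 := by
  sorry

/-! ### Stub statements by name -/

namespace Statement

/-- Statement of `stub_logScalingEndomorphism`. -/
abbrev stub_logScalingEndomorphism : Prop := type_of% @LogHomScaling.stub_logScalingEndomorphism
/-- Statement of `stub_scalingDescent`. -/
abbrev stub_scalingDescent : Prop := type_of% @LogHomScaling.stub_scalingDescent

end Statement

/-- Iterating a log-scaling endomorphism: `σ^k l = μ^k · l` on logarithms of algebraic numbers. -/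
theorem iterate_eq_pow_mul {μ : ℂ} {σ : ℂ →+* ℂ} (hσμ : σ μ = μ)
    (hσ : ∀ z : ℂ, IsAlgebraic ℚ (Complex.exp z) → σ z = μ * z) {z : ℂ}
    (hz : IsAlgebraic ℚ (Complex.exp z)) (k : ℕ) : (σ ^ k) z = μ ^ k * z := by
  induction k with
  | zero => simp
  | succ k ih =>
    rw [pow_succ', RingHom.coe_mul, Function.comp_apply, ih, map_mul, map_pow, hσμ, hσ z hz]
    ring

/-- COMPOSITION (kernel-checked, no sorry; stub statements BY NAME): LEAF 2 from the two stubs — apply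
`σ^k` to the relation (`σ^k` is a `ℚ`-algebra endomorphism of `ℂ`, so `σ^k (P(l)) = P(σ^k ∘ l) = P(μ^k • l)`),
then descend (stub 2). -/
theorem logHomogeneity_of (h₁ : Statement.stub_logScalingEndomorphism)
    (h₂ : Statement.stub_scalingDescent) : LogHomogeneityStatement := by
  intro r l halg P hP d
  obtain ⟨μ, σ, hμ0, hμ, hσμ, hσ⟩ := h₁
  refine h₂ r l P μ hμ0 hμ ?_ d
  intro k
  -- σ^k as a ℚ-algebra map
  set τ : ℂ →ₐ[ℚ] ℂ := (σ ^ k).toRatAlgHom with hτ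
  have hτapply : ∀ z, τ z = (σ ^ k) z := fun z => rfl
  have hcomp : (fun j => τ (l j)) = (μ ^ k) • l := by
    funext j
    rw [hτapply, iterate_eq_pow_mul hσμ hσ (halg j) k]
    rfl
  have h := congrArg τ hP
  rw [map_zero, MvPolynomial.comp_aeval_apply, hcomp] at h
  exact h

/-- LEAF 2 along this line MODULO exactly the two registered stubs (depends on `sorryAx` only through
`stub_*`). -/
theorem logHomogeneity_proof : LogHomogeneityStatement :=
  logHomogeneity_of stub_logScalingEndomorphism stub_scalingDescent

end Summit.Schanuel.Schanuel.Cruxes.LogSector.LogHomScaling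

end
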